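import Mathlib
import HarnessLib
import HarnessLib.Audit
import Summits.Langlands.Statement
import Literature.NumberTheory.Automorphic.LocalLanglandsGLProofs
import Literature.NumberTheory.Automorphic.LocalConstantsProofs
import HarnessLib.Audit.Status.Attr

/-!
Route: HeckeFieldDeRham

# Route HeckeFieldDeRham — the Hecke field certifies de Rham — reciprocity modulo p-adic Hodge
theory, L-arithmeticity, algebraic-trace rigidity

LENS `resurrect` (v3 §3.9) of the retired route AlgebraicTraceRigidity (closed 2026-08-15
`not-a-thesis`: its assembly stopped at a
GL₂/ℚ target), re-typed CRUX-ONLY into `_root_.Langlands` now that Fontaine's datum at v ∣ ℓ is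
PINNED (D-0018 L2, 2026-08-16), which
makes ATR typable datum-free for every n and F. It suffices to show X = X₁ ∧ X₂ ∧ X₃: X₁
(ReciprocityModuloDeRham) = the summit with
the p-adic-Hodge clause of (A) removed — one reciprocity datum per F; irreducible avatars with
Satake matching a.e., local–global
compatibility at v ∤ ℓ, compatibility at v ∣ ℓ CONDITIONAL on de Rham, uniqueness; (B) verbatim; X₂
(LArithmeticity) = Buzzard–Gee
Conj. 3.1.5 for cuspidal π of GL_n read through ι (the Hecke field is a number field); X₃
(AlgebraicTraceRigidity, Khare 2002 §4 Q3) =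
an irreducible, a.e. unramified ρ : Γ_F → GL_n(ℚ̄_ℓ) with Frobenius polynomials in ONE number field
is de Rham above ℓ for the pinned
datum. Card realised: algebraic-trace-rigidity-tangent-rank (spine; its T1 and Rung 2 ride as typed
supports).
Lean: `ReciprocityModuloDeRham ∧ LArithmeticity ∧ AlgebraicTraceRigidity`

## Assembly
Pure logic, PROVED (Sketch.lean `closes`, sorry-free; certified natively): fix F; X₁ gives Rec and,
for each L-algebraic cuspidal π and
(ℓ, ι), an irreducible ρ with Satake matching a.e. (hence a.e. unramified); X₂ gives a number field
E ⊂ ℚ̄_ℓ containing the Satake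
Frobenius polynomials a.e., so ρ is E-rational a.e. (`Filter.Eventually` intersection); X₃ makes ρ
de Rham at every v ∣ ℓ, which (i) is
the de Rham half of `IsGeometricFramed Rec ρ` (the pinned `Rec.pst` unfolds to
`fontainePstAdicCompletion`) and (ii) releases the
conditional local–global compatibility at v ∣ ℓ; with compatibility at v ∤ ℓ this is `Corresponds`,
uniqueness is carried, so (A); (B) is
the second conjunct of X₁; hence `GlobalLanglandsCorrespondenceGLn n F Rec hcpt` for all n, i.e.
`Langlands`.

Rationale: WHY THIS LINE. Every known construction of ρ_π off the regular Shimura-variety regime is a p-adic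
LIMIT (congruences, torsion classes, eigenvarieties) and
"p-adic limits of de Rham Galois representations need not be de Rham"
(A'Campo–Hevesi–Thorne–Whitmore arXiv:2607.11763 p. 5, who pay the
whole 10-author degree-shifting machinery to prove the de Rham clause for REGULAR π over CM fields,
Thm 1.2.1); the one property every such
limit of an arithmetic eigensystem keeps for free is that its traces lie in a number field. ATR
(Khare arXiv:math/0210403 §4 Q3; rank one =
Serre–Henniart–Waldschmidt, Waldschmidt doi:10.1007/bf01389195, via the Masser–Waldschmidt / Roy
rank theorems) converts exactly that
property into de Rham-ness, so the summit's p-adic-Hodge clause is discharged by TRANSCENDENCE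
THEORY (imported: Brumer's p-adic Baker,
Roy 1992 Thm 4/5/Cor 1 — vendored as `brumer1967_thm1`, `roy1992_padic_thm4/thm5/cor1` over
`padicLogAlgCl`) uniformly in n, F and weight,
with the first-order case essentially in print (Betina–Maksoud–Pozzi arXiv:2502.00876 Prop 2.3 / Cor
6.2). None of the 50 open routes of
this sub uses transcendence on Frobenius traces (nearest: CapacityClassicality — Bost–Chambert-Loir
capacity on E-integral q-expansions,
a (B)-engine on the automorphic object; SenNullAlignment — geometric Sen theory at partial weight
one); the negatives index (3 entries)
has nothing of this kind. What is new relative to the retired route: ATR typed over the pinned datum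
for all (n, F); the remainder of the
summit declared as CRUXES consumed by `closes`; L-arithmeticity named as the junction; T1 demoted to
a theorem-sized support (variant of BMP).

RANKED CRUXES. #2 AlgebraicTraceRigidity (crux) — ATR (Khare 2002 §4 Question 3 / "stronger
question", finitely-ramified form; card conjecture): for every number field F, n, ℓ and every
IRREDUCIBLE ρ : Γ_F → GL_n(ℚ̄_ℓ) unramified at all but finitely many places whose
arithmetic-Frobenius characteristic polynomials at all but finitely many places have coefficients in
one subfield E ⊂ ℚ̄_ℓ finite over ℚ, ρ|_(Γ_(F_v)) is de Rham for Fontaine's pinned datum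
`fontainePstAdicCompletion v ℓ hv` at every v ∣ ℓ (= the summit's `IsGeometricFramed` de Rham
clause, datum-free). Rank one is the Serre–Henniart–Waldschmidt theorem; irreducibility, ONE E and
finite ramification are each essential (Henniart's (χ, log χ); half-twists;
Khare–Larsen–Ramakrishna). [difficulty: open-problem] (why it might fail: beyond first order no
transcendence tool exists (four-exponentials/p-adic-Schanuel strength); ONE irreducible
a.e.-unramified E-rational ρ that is not de Rham — e.g. a non-classical ordinary weight-one p-adic
eigenform with number-field Hecke eigenvalues — kills it.) [arXiv:math/0210403,
doi:10.1007/bf01389195, Roy1992, Brumer1967, arXiv:2502.00876, arXiv:math/0309283, arXiv:2404.08954]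
#3 LArithmeticity (crux) — Buzzard–Gee 2014 Conj. 3.1.5, direction "L-algebraic ⟹ L-arithmetic", G =
GL_n, cuspidal π, read through ι on the predicted arithmetic-Frobenius polynomials: for every
L-algebraic cuspidal π of GL_n(𝔸_F) and every ℓ, ι there is a subfield E ⊂ ℚ̄_ℓ, finite over ℚ,
containing the coefficients of `arithFrobPolyOfSatake ι q_v 1 α = ∏ (X − ι⁻¹(α_j⁻¹))` for every
Satake parameter α of π at all but finitely many v. Equivalent to the tree's named conjecture
`Literature.NumberTheory.Automorphic.lArithmetic_of_lAlgebraic` restricted to cuspidal π (reciprocal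
polynomial: e_k(α⁻¹) = e_(n−k)(α)/e_n(α), e_n(α) ≠ 0 by `hasSatakeParamAt_ne_zero`; transport of E
along ι). Known for regular algebraic π (Clozel 1990 Thm 3.13 = fact
`Clozel1990_heckeEigenvalueField` up to the C/L half-twist; rank one PROVED in tree,
`Clozel1990_regularAlgebraic.rank_one`); OPEN for irregular π. [difficulty: open-problem] (why it
might fail: "seemingly completely out of reach" (BG p. 13) for irregular π: a Maass cusp form of
eigenvalue 1/4 or a non-degenerate limit of discrete series with ONE transcendental unramified Hecke
eigenvalue refutes it; no finite computation decides a single case.) [arXiv:1009.0785, Clozel1990,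
BuzzardGeeLMS2014]
#4 ReciprocityModuloDeRham (crux) — THE REST OF THE MOUNTAIN, declared (implied by the summit; both
directions minus the p-adic-Hodge clause of (A)): for every number field F there is ONE reciprocity
datum Rec such that for all n ≥ 1 and hcpt: (A°) every L-algebraic cuspidal π has, for all ℓ, ι, an
IRREDUCIBLE ρ with Satake–Frobenius matching at all but finitely many v, `LocalGlobalCompatibleAt`
at every v ∤ ℓ, `LocalGlobalCompatibleAt` at v ∣ ℓ CONDITIONAL on ρ|_(Γ_(F_v)) being de Rham for the
pinned datum, and uniqueness up to conjugacy among all ρ′ with `Corresponds Rec ι π ρ′`; and (B)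
`GaloisToAutomorphic n Rec hcpt` verbatim. The irregular sector of (A°), ℓ = p compatibility (known
semisimplified for regular π over CM, arXiv:2607.11763 Thm 1.2.1) and all of (B) live here; children
= the sector routes of this sub. [difficulty: open-problem] (why it might fail: contains direction
(B) and the existence of ρ_π for irregular π over arbitrary F — the open core of the summit; fails
exactly if the summit fails off its de Rham clause (e.g. a cuspidal L-algebraic π with no ℓ-adic
avatar, or a geometric irreducible ρ with no π).) [BuzzardGeeLMS2014, FontaineMazurGeometric1995,
arXiv:2607.11763, HarrisLanTaylorThorneRMS2016, Scholze2015]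
#9 OrdinaryArtinWeightRigidity (support) — RUNG 2 of the card = the GL₂/ℚ ordinary Artin-weight
SECTOR of ATR in datum-free form (conclusion "ρ(I_p) finite" instead of the pinned de Rham
predicate; the kill-criterion carrier): ρ : Γ_ℚ → GL₂(ℚ̄_p) irreducible, a.e. unramified, E-rational
for one subfield E ⊂ ℚ̄_p finite over ℚ, ordinary at p with both diagonal inertial characters of
finite order ⟹ the inertia image at p is finite (= de Rham of Hodge–Tate weights (0,0), Sen).
Contrapositive: a non-classical ordinary p-adic eigenform of weight one has a Hecke field of
infinite degree (cf. Khare 2002 Question 2; Hida's growth theorems at arithmetic points).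
[difficulty: open-problem] [arXiv:math/0210403, Hida2010, doi:10.1090/s0894-0347-2010-00680-7,
Kisin2003]
#9 TangentRigidity (support) — T1 of the card (ATR to first order at odd Artin points of GL₂/ℚ, all
of H¹ incl. the determinant direction), theorem-sized after Betina–Maksoud–Pozzi Prop 2.3 / Cor 6.2
(trace derivatives at seven Chebotarev primes determine a first-order deformation; "E-rational"
adjoins one constant column, 1 ∈ 𝓛̃): ρ odd irreducible with finite image, ρε a first-order
deformation unramified a.e.; if the ε-parts of tr ρε(Frob_v) lie in c₀·ℚ̄ (ℚ̄ = `padicQbar p`) at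
almost all v then they vanish at almost all v. Tools vendored: `brumer1967_thm1`,
`roy1992_padic_thm4`, `roy1992_padic_thm5`, `roy1992_padic_cor1`, `padicLogAlgCl`. Calibration of
the engine; the Monday-morning lemma of the line. [difficulty: L] [arXiv:2502.00876,
doi:10.1007/978-3-319-69712-3_4, doi:10.1016/j.aim.2015.07.007, arXiv:1301.0712, Roy1992,
Brumer1967]

TWO-LAYER PLAN. Foreseen glued splits (k ≤ 3, depth 1; the BC3 birth skeletons, published as
Lines/birth.lean on each crux): AlgebraicTraceRigidity ⇐
Companions (an irreducible a.e.-unramified E-rational ℓ-adic ρ extends to an E-rational weakly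
compatible family over all ℓ′ — the
horizontal half, where potential automorphy / Brauer–Taylor produce companions) → SystemDeRham (an
irreducible ℓ-adic member of such a
family is de Rham above ℓ — the vertical half: the Sen polynomial of ρ|_(Γ_(F_v)) against the v-adic
slopes of the companions' Frobenius at
v, the first local transcendence target) → ATR. LArithmeticity ⇐ regular sector (Clozel,
theorem-sized) → irregular sector (open core) → LA.
ReciprocityModuloDeRham ⇐ TR/CM core → base-field ascent → RMD (the seams of
BaseFieldAscent/LiftDescend; their items attach as children).

KILL CRITERIA. An irreducible, a.e. unramified, E-rational ρ that is not de Rham above ℓ closes the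
route `refuted:AlgebraicTraceRigidity` — concretely ONE
ordinary non-classical weight-one p-adic eigenform with Hecke eigenvalues in a number field (refutes
OrdinaryArtinWeightRigidity and ATR at
once), or ONE positive-slope overconvergent eigenform of weight ≤ 1 with number-field eigenvalues
(ATR via Kisin). A cuspidal L-algebraic π
with a provably transcendental unramified Hecke eigenvalue closes it `refuted:LArithmeticity`. A
classical weight-one point with an
E-rational tangent direction refutes TangentRigidity only (support): pivot the Attack narrative,
route survives. MOOTED (not refuted) if
p-adic Hodge theory proves de Rham-ness of all E-rational eigenvariety limits directly, or if every
avatar construction comes with its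
own de Rham proof (as arXiv:2607.11763 now does for regular π over CM): then ATR is
true-but-unneeded and the route is superseded.

NOT DECOMPOSED YET. RMD (deliberately monolithic: the summit's ∃Rec forces (A°) and (B) under ONE
datum; its sectors are the other routes of this sub and
attach as children when they close); the layer-2 children named in the two-layer plan; the transport
lemma `lArithmetic_of_lAlgebraic`
(cuspidal) → LArithmeticity (reciprocal polynomial + ι; provable-now, filed on demand); the
finite-slope / trianguline avatar of Rung 2
(needs `TriangulineAt`); general-F, general-n versions of T1 (d = 4[F:ℚ]·? + 1 columns, heavier Roy
census); the Literature facts Henniart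
1982 Thms 2/7 and Masser–Waldschmidt Thm 8 (rank-one ATR) — cite requests, not items.

CHEAPEST FALSIFIER. Compute to ≥ 300 p-adic bits the U_p-ordinary weight-one eigenforms of a small
non-CM tame level (p ∈ {3, 5, 7}, N ≤ 50; Hida/Lauder
algorithms or overconvergent modular symbols) and run p-adic LLL on (λ(U_p), a_2, a_3, a_5, a_7,
a_11) for algebraic relations of degree ≤ 12
with planted controls: ONE algebraic non-classical ordinary weight-one eigenform refutes
OrdinaryArtinWeightRigidity and ATR. Already run
(card, 2026-08-15): the positive-slope 2-adic tame-level-1 weight-0 slope-3 Buzzard–Calegari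
eigenform to 412 bits, degree ≤ 12, controls
recovered — NEGATIVE, as ATR requires. Lookups done this session: Khare math/0210403 §4 (p. 7: Q3
printed, m = 1 known); BMP 2502.00876
pp. 7, 25 (Prop 2.3 = Roy–Waldschmidt, Cor 6.2 = first-order rigidity at 7 primes); ACHTW 2607.11763
pp. 4–5; BG 1009.0785 p. 13.

NUMBERS. Roy 1992: φ(n, n+1) = n(n+1), so φ(4, 5) = 20 and ≥ 21 ℚ̄-independent admissible prime
columns are needed for T1 in d = 5 (`roy1992_padic_thm5.finrank_le_twenty`);
Roy Cor 1: rank ≥ θ̃·d/(1+θ̃), an algebraic row forces θ̃ ≤ 1 (half rank only — why the rank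
theorem, not Cor 1, is the tool); BMP Cor 6.2: 7 regular primes
suffice for a 3 × 7 DLR matrix of rank 3 (exotic case), 4 primes in the RM case; card census: 412
bits, degree ≤ 12, heights to 2^124 (deg 2) … 2^28 (deg 12), negative;
ACHTW Thm 1.2.1: HT_τ(r_(π,ι)) = {λ_(ιτ,1) + n − 1, …, λ_(ιτ,n)} for regular π over CM (the
regular-CM case of ATR's conclusion, by a different method).

DEFINITION REQUESTS. None new: `padicLogAlgCl`, `padicQbar`, `brumer1967_thm1`,
`roy1992_padic_thm4/thm5/cor1` already landed (Literature/NumberTheory/Transcendental) from the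
retired route's requests.
Cite facts wanted later (not blocking): Henniart 1982 Thms 2/7 and Masser–Waldschmidt Thm 8
(rank-one ATR), topic Literature/NumberTheory/Transcendental.

Novelty: Searches (2026-08-17): `lit search --hybrid "Galois representations regular algebraic cuspidal CM
field de Rham"` (12; found arXiv:2607.11763, READ pp. 1–5); `lit read arXiv:math/0210403 --grep
Question` (READ p. 7: Q1–Q3); `lit read arXiv:2502.00876 --grep 'Proposition 2.3|Corollary 6.2'`
(READ pp. 7, 25); `lit read arXiv:1009.0785 --grep L-arithmetic` (READ p. 13); `lit search` remote
cascade: OpenAlex HTTP 429 (daily budget exhausted), local searchd reset twice (noted); `lean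
search` ×5 (ReciprocityModuloDeRham / LArithmeticity unused names; AlgebraicTraceRigidity only in
the retired file; lArithmetic_of_lAlgebraic vendored; transcendence facts vendored); `ledger
negatives --problem Langlands` (3, unrelated); grep of all 76 Theses files for the card slug / T1 /
ATR decls (only the retired route); plus the card's and the two refuter audits' searches (aud-17/18:
BMP located and read at the page).
Nearest prior art found: arXiv:math/0210403 (Khare 2002 §4 Question 3 = ATR as a printed question, m
= 1 known); arXiv:2502.00876 (Betina–Maksoud–Pozzi, Crelle 2026: Prop 2.3 Roy–Waldschmidt rank
bound, Cor 6.2 first-order trace rigidity at weight-one points — T1's mechanism in print);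
doi:10.1007/bf01389195 + Henniart 1982 (rank-one ATR); arXiv:1009.0785 Conj. 3.1.5
(L-arithmeticity); arXiv:2607.11763 (ACHTW 2026: the de Rham clause for regular π over CM by degree
shifting — the clause this route discharges by other means); in-ledger: the retired
route-Langlands-AlgebraicTraceRigid  [refs: 10.1007/bf01389195, 2607.11763, math/0210403, 2502.00876, 1009.0785, doi:10.1007/bf01389195]

Barriers (technique_class: transcendence, p-adic-logarithms, roy-rank-theorem): - technique_class: transcendence, p-adic-logarithms, roy-rank-theorem
- Literature.Barriers.Langlands.NonRegularWeightBarrier: partially evaded — the de Rham clause of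
(A) at irregular weight is certified from the Hecke field alone (escaping hypothesis: no
Shimura-variety, eigenvariety or completed-cohomology realisation of π enters ATR or
LArithmeticity); NOT evaded for the EXISTENCE of ρ_π or for (B), which sit inside
ReciprocityModuloDeRham and are exactly this wall — said plainly.
- Literature.Barriers.Langlands.ShimuraVarietyRealizationBarrier: same status — ATR and
LArithmeticity carry no totally-real/CM hypothesis (rank one holds over every F); over a CM-less F
the route reduces the (A)-side p-adic Hodge theory to trace matching; the realisation of ρ_π itself
is not evaded (inside RMD).
- Literature.Barriers.Langlands.PatchingLocalComponentBarrier: not engaged — no deformation ring is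
patched; T1 uses only the tangent space H¹ and class field theory of the adjoint splitting field.
- Literature.Barriers.Langlands.TaylorWilesNumericalCoincidence: not engaged — no Taylor–Wiles
system anywhere on the line.
- Literature.Barriers.Langlands.ResiduallyReducibleBarrier: not engaged — irreducibility of ρ itself
is a hypothesis of ATR (and essential); nothing residual is assumed.
- Literature.Barriers.Langlands.SolvableImageBarrier: not engaged — no base change; finite-image ρ
are the EASY case of ATR (potentially unramified).
- Literature.Barriers.Langlands.TwistedEndoscopySelfD

History (route lifecycle, newest last):
- 2026-08-17T02:09:56Z · rev 2: restated TangentRigidity (stmt-Langlands-17412) — route-repair (cone, unit rrepair-Langlands-HeckeFieldDeRham-e3a2f7d4): imports −Literature.NumberTheory.Transcendental.BrumerPadicBaker. That import dragged, vi (planner-rrepair-Langlands-HeckeFieldDeRham-e3a2f7d4-0)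
- 2026-08-26T03:39:04Z · DORMANT — reconciler: no traction for 8.3 d (last activity item-evidence-added at 2026-08-17T19:22:15Z); parked, not closed — `ledger route dormant route-Langlands-HeckeF (operator:999:2457025)
- 2026-08-26T04:26:10Z · REACTIVATED — reconciler: reactivated — activity route-repaired at 2026-08-26T03:39:21Z after parking at 2026-08-26T03:39:04Z (operator:999:2718269)
- 2026-08-27T15:10:19Z · STALE-VERDICT (tier-A confirmation): L346: Application type mismatch: The argument   Rec has type   ReciprocityData F of sort `Type 1` but is expected to have type   Nonempty (ReciprocityData F) of (operator:gate5)

sub-problem: Langlands · status: open · opened planner-plan-lens3-Langlands-resurrect-0 2026-08-17T01:55:53Z · rev 3 · ledger route-Langlands-HeckeFieldDeRham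
GENERATED by the gate from the ledger (D-0016/17). Provers cite these decls: `theorem foo : Summit.Langlands.Langlands.Theses.HeckeFieldDeRham.<Decl> := …` in Summits/Langlands/Langlands/Theorems/<Name>.lean.
-/

namespace Summit.Langlands.Langlands.Theses.HeckeFieldDeRham

open scoped BigOperators Topology Manifold Classical MeasureTheory ProbabilityTheory Matrix InnerProductSpace ComplexConjugate ContinuousMap
open Filter Set Function TopologicalSpace MeasureTheory

attribute [summit_statement] _root_.Langlands

/-- item stmt-Langlands-17408 · crux · rank 2 · open · by planner
why it might fail: beyond first order no transcendence tool exists (four-exponentials/p-adic-Schanuel strength); ONE irreducible a.e.-unramified E-rational ρ that is not de Rham — e.g. a non-classical ordinary weight-one p-adic eigenform with number-field Hecke eigenvalues — kills it.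
sources: arXiv:math/0210403, doi:10.1007/bf01389195, Roy1992, Brumer1967, arXiv:2502.00876, arXiv:math/0309283
[crux] ATR (Khare 2002 §4 Question 3 / "stronger question", finitely-ramified form; card
conjecture): for every number field F, n, ℓ and every IRREDUCIBLE ρ : Γ_F → GL_n(ℚ̄_ℓ) unramified at
all but finitely many places whose arithmetic-Frobenius characteristic polynomials at all but
finitely many places have coefficients in one subfield E ⊂ ℚ̄_ℓ finite over ℚ, ρ|_(Γ_(F_v)) is de
Rham for Fontaine's pinned datum `fontainePstAdicCompletion v ℓ hv` at every v ∣ ℓ (= the summit's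
`IsGeometricFramed` de Rham clause, datum-free). Rank one is the Serre–Henniart–Waldschmidt theorem;
irreducibility, ONE E and finite ramification are each essential (Henniart's (χ, log χ);
half-twists; Khare–Larsen–Ramakrishna). [difficulty: open-problem] -/
@[route_item "route-Langlands-HeckeFieldDeRham", crux]
def AlgebraicTraceRigidity : Prop :=
  ∀ (F : Type) [Field F] [NumberField F] (n ℓ : ℕ) [Fact ℓ.Prime] (ρ : Literature.NumberTheory.GaloisRepresentations.FramedGaloisRep F (PadicAlgCl ℓ) n), ρ.toGaloisRep.IsIrreducible → (∀ᶠ v : IsDedekindDomain.HeightOneSpectrum (NumberField.RingOfIntegers F) in Filter.cofinite, ρ.IsUnramifiedAt v) → (∃ E : Subfield (PadicAlgCl ℓ), FiniteDimensional ℚ E ∧ ∀ᶠ v : IsDedekindDomain.HeightOneSpectrum (NumberField.RingOfIntegers F) in Filter.cofinite, ∃ P : Polynomial (PadicAlgCl ℓ), (∀ i : ℕ, P.coeff i ∈ E) ∧ ρ.HasFrobCharpolyAt v P) → ∀ (v : IsDedekindDomain.HeightOneSpectrum (NumberField.RingOfIntegers F)) (hv : ((ℓ : ℕ) : NumberField.RingOfIntegers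 F) ∈ v.asIdeal), (Literature.NumberTheory.PAdicHodge.fontainePstAdicCompletion v ℓ hv).IsDeRhamFramed (ρ.toLocal v)

/-- item stmt-Langlands-17409 · crux · rank 3 · open · by planner
why it might fail: "seemingly completely out of reach" (BG p. 13) for irregular π: a Maass cusp form of eigenvalue 1/4 or a non-degenerate limit of discrete series with ONE transcendental unramified Hecke eigenvalue refutes it; no finite computation decides a single case.
sources: arXiv:1009.0785, Clozel1990, BuzzardGeeLMS2014
[crux] Buzzard–Gee 2014 Conj. 3.1.5, direction "L-algebraic ⟹ L-arithmetic", G = GL_n, cuspidal π,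
read through ι on the predicted arithmetic-Frobenius polynomials: for every L-algebraic cuspidal π
of GL_n(𝔸_F) and every ℓ, ι there is a subfield E ⊂ ℚ̄_ℓ, finite over ℚ, containing the coefficients
of `arithFrobPolyOfSatake ι q_v 1 α = ∏ (X − ι⁻¹(α_j⁻¹))` for every Satake parameter α of π at all
but finitely many v. Equivalent to the tree's named conjecture
`Literature.NumberTheory.Automorphic.lArithmetic_of_lAlgebraic` restricted to cuspidal π (reciprocal
polynomial: e_k(α⁻¹) = e_(n−k)(α)/e_n(α), e_n(α) ≠ 0 by `hasSatakeParamAt_ne_zero`; transport of E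
along ι). Known for regular algebraic π (Clozel 1990 Thm 3.13 = fact
`Clozel1990_heckeEigenvalueField` up to the C/L half-twist; rank one PROVED in tree,
`Clozel1990_regularAlgebraic.rank_one`); OPEN for irregular π. [difficulty: open-problem] -/
@[route_item "route-Langlands-HeckeFieldDeRham", crux]
def LArithmeticity : Prop :=
  ∀ (n : ℕ) (F : Type) [Field F] [NumberField F] (hcpt : Literature.NumberTheory.Automorphic.isCompact_glFiniteIntegralLevel n F) (π : Literature.NumberTheory.Automorphic.CuspidalAutomorphicRepData n F hcpt), π.1.IsLAlgebraic → ∀ (ℓ : ℕ) [Fact ℓ.Prime] (ι : PadicAlgCl ℓ ≃+* ℂ), ∃ E : Subfield (PadicAlgCl ℓ), FiniteDimensional ℚ E ∧ ∀ᶠ v : IsDedekindDomain.HeightOneSpectrum (NumberField.RingOfIntegers F) in Filter.cofinite, ∀ α : Multiset ℂ, π.1.HasSatakeParamAt v α → ∀ i : ℕ, (Literature.NumberTheory.Automorphic.arithFrobPolyOfSatake ι v.residueCard 1 α).coeff i ∈ E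

/-- item stmt-Langlands-17410 · crux · rank 4 · open · by planner
why it might fail: contains direction (B) and the existence of ρ_π for irregular π over arbitrary F — the open core of the summit; fails exactly if the summit fails off its de Rham clause (e.g. a cuspidal L-algebraic π with no ℓ-adic avatar, or a geometric irreducible ρ with no π).
sources: BuzzardGeeLMS2014, FontaineMazurGeometric1995, arXiv:2607.11763, HarrisLanTaylorThorneRMS2016, Scholze2015
[crux] THE REST OF THE MOUNTAIN, declared (implied by the summit; both directions minus the
p-adic-Hodge clause of (A)): for every number field F there is ONE reciprocity datum Rec such that
for all n ≥ 1 and hcpt: (A°) every L-algebraic cuspidal π has, for all ℓ, ι, an IRREDUCIBLE ρ with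
Satake–Frobenius matching at all but finitely many v, `LocalGlobalCompatibleAt` at every v ∤ ℓ,
`LocalGlobalCompatibleAt` at v ∣ ℓ CONDITIONAL on ρ|_(Γ_(F_v)) being de Rham for the pinned datum,
and uniqueness up to conjugacy among all ρ′ with `Corresponds Rec ι π ρ′`; and (B)
`GaloisToAutomorphic n Rec hcpt` verbatim. The irregular sector of (A°), ℓ = p compatibility (known
semisimplified for regular π over CM, arXiv:2607.11763 Thm 1.2.1) and all of (B) live here; children
= the sector routes of this sub. [difficulty: open-problem] -/
@[route_item "route-Langlands-HeckeFieldDeRham", crux]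
def ReciprocityModuloDeRham : Prop :=
  ∀ (F : Type) [Field F] [NumberField F], ∃ Rec : Summit.Langlands.ReciprocityData F, ∀ n : ℕ, 0 < n → ∀ hcpt : Literature.NumberTheory.Automorphic.isCompact_glFiniteIntegralLevel n F, (∀ π : Literature.NumberTheory.Automorphic.CuspidalAutomorphicRepData n F hcpt, π.1.IsLAlgebraic → ∀ (ℓ : ℕ) [Fact ℓ.Prime] (ι : PadicAlgCl ℓ ≃+* ℂ), ∃ ρ : Literature.NumberTheory.GaloisRepresentations.FramedGaloisRep F (PadicAlgCl ℓ) n, ρ.toGaloisRep.IsIrreducible ∧ (∀ᶠ v : IsDedekindDomain.HeightOneSpectrum (NumberField.RingOfIntegers F) in Filter.cofinite, Summit.Langlands.SatakeFrobCompatibleAt ι π.1 ρ v) ∧ (∀ v : IsDedekindDomain.HeightOneSpectrum (NumberField.RingOfIntegers F), ((ℓ : ℕ) : NumberField.RingOfIntegers F) ∉ v.asIdeal → Summit.Langlands.LocalGlobalCompatibleAt Rec ι π.1 ρ v) ∧ (∀ (v : IsDedekindDomain.HeightOneSpectrum (NumberField.RingOfIntegers F)) (hv : ((ℓ : ℕ)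 : NumberField.RingOfIntegers F) ∈ v.asIdeal), (Rec.pst ℓ v hv).IsDeRhamFramed (ρ.toLocal v) → Summit.Langlands.LocalGlobalCompatibleAt Rec ι π.1 ρ v) ∧ (∀ ρ' : Literature.NumberTheory.GaloisRepresentations.FramedGaloisRep F (PadicAlgCl ℓ) n, Summit.Langlands.Corresponds Rec ι π.1 ρ' → Summit.Langlands.IsConjugate ρ ρ')) ∧ Summit.Langlands.GaloisToAutomorphic n Rec hcpt

/-- item stmt-Langlands-17411 · support · rank 9 · open · by planner
sources: arXiv:math/0210403, Hida2010, doi:10.1090/s0894-0347-2010-00680-7, Kisin2003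
[support] RUNG 2 of the card = the GL₂/ℚ ordinary Artin-weight SECTOR of ATR in datum-free form
(conclusion "ρ(I_p) finite" instead of the pinned de Rham predicate; the kill-criterion carrier): ρ
: Γ_ℚ → GL₂(ℚ̄_p) irreducible, a.e. unramified, E-rational for one subfield E ⊂ ℚ̄_p finite over ℚ,
ordinary at p with both diagonal inertial characters of finite order ⟹ the inertia image at p is
finite (= de Rham of Hodge–Tate weights (0,0), Sen). Contrapositive: a non-classical ordinary p-adic
eigenform of weight one has a Hecke field of infinite degree (cf. Khare 2002 Question 2; Hida's
growth theorems at arithmetic points). [difficulty: open-problem] -/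
@[route_item "route-Langlands-HeckeFieldDeRham"]
def OrdinaryArtinWeightRigidity : Prop :=
  ∀ (p : ℕ) [Fact p.Prime] (ρ : Literature.NumberTheory.GaloisRepresentations.FramedGaloisRep ℚ (PadicAlgCl p) 2), ρ.toGaloisRep.IsIrreducible → (∀ᶠ v : IsDedekindDomain.HeightOneSpectrum (NumberField.RingOfIntegers ℚ) in Filter.cofinite, ρ.IsUnramifiedAt v) → (∃ E : Subfield (PadicAlgCl p), FiniteDimensional ℚ E ∧ ∀ᶠ v : IsDedekindDomain.HeightOneSpectrum (NumberField.RingOfIntegers ℚ) in Filter.cofinite, ∃ P : Polynomial (PadicAlgCl p), (∀ i, P.coeff i ∈ E) ∧ ρ.HasFrobCharpolyAt v P) → ∀ v : IsDedekindDomain.HeightOneSpectrum (NumberField.RingOfIntegers ℚ), ((p : ℕ) : NumberField.RingOfIntegers ℚ) ∈ v.asIdeal → (∃ m : ℕ, 0 < m ∧ ∃ Q : Matrix.GeneralLinearGroup (Fin 2) (PadicAlgCl p), ∀ σ : Field.absoluteGaloisGroup (v.adicCompletion ℚ), (Q⁻¹ * ρ.toLocal v σ * Q).val 1 0 = 0 ∧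 (σ ∈ Literature.NumberTheory.GaloisRepresentations.absInertia (v.adicCompletion ℚ) → (Q⁻¹ * ρ.toLocal v σ * Q).val 1 1 ^ m = 1 ∧ (Q⁻¹ * ρ.toLocal v σ * Q).val 0 0 ^ m = 1)) → Set.Finite ((fun σ => ρ.toLocal v σ) '' (Literature.NumberTheory.GaloisRepresentations.absInertia (v.adicCompletion ℚ) : Set (Field.absoluteGaloisGroup (v.adicCompletion ℚ))))

-- earlier TangentRigidity (stmt-Langlands-17412, replaced 2026-08-17T02:09:56Z -> stmt-Langlands-17770): retired by None — ∀ (p : ℕ) [Fact p.Prime] (ρ : Literature.NumberTheory.GaloisRepresentations.FramedGaloisRep ℚ (PadicAlgCl p) 2) (ρε : Literature.NumberTheory.GaloisRepresentations.FramedGaloisRep ℚ (DualNumber (PadicAlgCl p)) 2), Finite ρ.toMonoidHom.range → ρ.toGaloisRep.IsIrreducible → ρ.IsOd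
/-- item stmt-Langlands-17770 · support · rank 9 · open · by planner
sources: arXiv:2502.00876, doi:10.1007/978-3-319-69712-3_4, doi:10.1016/j.aim.2015.07.007, arXiv:1301.0712, Roy1992, Brumer1967
[support] T1 of the card (ATR to first order at odd Artin points of GL₂/ℚ, all of H¹ incl. the
determinant direction), theorem-sized after Betina–Maksoud–Pozzi Prop 2.3 / Cor 6.2 (trace
derivatives at seven Chebotarev primes determine a first-order deformation; "E-rational" adjoins one
constant column, 1 ∈ 𝓛̃): ρ odd irreducible with finite image, ρε a first-order deformation
unramified a.e.; if the ε-parts of tr ρε(Frob_v) lie in c₀·ℚ̄ at almost all v then they vanish at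
almost all v. Here ℚ̄ = Mathlib `algebraicClosure ℚ (PadicAlgCl p)` (= the tree abbrev
`Literature.NumberTheory.Transcendental.padicQbar p`, unfolded so the route file needs no
Transcendental import; restated 1:1, `Iff.rfl` with the rev-1 text). Tools for the proof, all PROVED
in tree and to be imported by the Theorems file (not by the route file): `brumer1967_thm1_holds`,
`roy1992_padic_thm4_holds`, `roy1992_padic_thm5_holds`, `roy1992_padic_cor1_holds`,
`padicLogAlgCl_isIwasawaLog_holds`. Calibration of the engine; the Monday-morning lemma of the line.
[difficulty: L] -/
@[route_item "route-Langlands-HeckeFieldDeRham"]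
def TangentRigidity : Prop :=
  ∀ (p : ℕ) [Fact p.Prime] (ρ : Literature.NumberTheory.GaloisRepresentations.FramedGaloisRep ℚ (PadicAlgCl p) 2) (ρε : Literature.NumberTheory.GaloisRepresentations.FramedGaloisRep ℚ (DualNumber (PadicAlgCl p)) 2), Finite ρ.toMonoidHom.range → ρ.toGaloisRep.IsIrreducible → ρ.IsOdd → (∀ g : Field.absoluteGaloisGroup ℚ, ((ρε g).val).map TrivSqZeroExt.fst = (ρ g).val) → (∀ᶠ v : IsDedekindDomain.HeightOneSpectrum (NumberField.RingOfIntegers ℚ) in Filter.cofinite, ρε.IsUnramifiedAt v) → ∀ c₀ : PadicAlgCl p, (∀ᶠ v : IsDedekindDomain.HeightOneSpectrum (NumberField.RingOfIntegers ℚ) in Filter.cofinite, ∀ Pv ∈ v.primesAbove, ∀ σ : Field.absoluteGaloisGroup ℚ, IsArithFrobAt (NumberField.RingOfIntegers ℚ) σ Pv → ∃ a ∈ algebraicClosure ℚ (PadicAlgCl p), ((ρε σ).val.trace).snd = c₀ * a) → ∀ᶠ v : IsDedekindDomain.HeightOneSpectrum (NumberField.RingOfIntegers ℚ) in Filter.cofinite,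 ∀ Pv ∈ v.primesAbove, ∀ σ : Field.absoluteGaloisGroup ℚ, IsArithFrobAt (NumberField.RingOfIntegers ℚ) σ Pv → ((ρε σ).val.trace).snd = 0

/-- item stmt-Langlands-23603 · support · rank 9 · open · by planner
why it might fail: only via the datum axioms: a pinned LocalLanglandsDatum differing from Harris–Taylor rec on a generic class (Henniart-sharpness of IsLocalLanglandsGL) would break the transfer; print says it cannot (Henniart 1993 Thm 1.1, AHTW 2026 Prop 6.0.5).
sources: Henniarts1993, BuzzardGeeLMS2014, arXiv:2607.11763, stmt-Langlands-23603
[support] [piece R of the L∤R split; verbatim the registered stub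
`…CompatibilityAwayFromLR.Birth.stub_recRigidity`; WEAKER (L∤R forces it: landed
`Theorems/CompatibilityAwayFromLR/Negative/RigidOfCompatibilityAwayFromLR.lean`,
`recGL_eq_of_compatibilityAwayFromLR`); leaf ATTACKABLE closed-mod-print: conclusion of the landed
glue `ReciprocityUpToIrreducibilityR.stub_recRigidityLAlg_of_genericRigidity ∘
stub_genericRigidity_of_facts` from five local facts (localLanglands_gl, generic preimages, Henniart
2002 Thm 1.7(a) / 1.6(b), invariant measures); critic: CLEARED decomp-langlands-crit-1-g0 0
2026-08-30T01:15:58Z (pub/decomp-langlands/STATUS.md; CRITIC-LEDGER.md row 01:15:58Z)] any two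
pinned reciprocity data give the same class rec_v(π_v) to every local component of every L-algebraic
cuspidal π (Henniart's uniqueness of rec_v on generic classes; local components of cusp forms are
generic by Shalika). [difficulty: provable-now] -/
@[route_item "route-Langlands-HeckeFieldDeRham", crux]
def RecRigidity : Prop :=
  ∀ (K : Type) [Field K] [NumberField K] (Rec Rec' : ReciprocityData K) (n : ℕ) (hcpt : Literature.NumberTheory.Automorphic.isCompact_glFiniteIntegralLevel n K), 0 < n → ∀ (π : Literature.NumberTheory.Automorphic.CuspidalAutomorphicRepData n K hcpt), π.1.IsLAlgebraic → ∀ (v : IsDedekindDomain.HeightOneSpectrum (NumberField.RingOfIntegers K)) (πv : Literature.NumberTheory.Automorphic.SmoothIrrep (Matrix.GeneralLinearGroup (Fin n) (v.adicCompletion K))), π.1.HasLocalComponentAt v πv.ρ → (Rec.llc v).recGL n (Literature.NumberTheory.Automorphic.IrrClass.mk πv) = (Rec'.llc v).recGL n (Literature.NumberTheory.Automorphic.IrrClass.mk πv)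

/-- item stmt-Langlands-17413 · assembly · rank 1 · open · by planner
sources: BuzzardGeeLMS2014, FontaineMazurGeometric1995
[assembly] ReciprocityModuloDeRham → LArithmeticity → AlgebraicTraceRigidity → Langlands (the shape
of the deciding theorem `closes`, proved sorry-free in Sketch.lean and rendered in the route file). -/
@[route_item "route-Langlands-HeckeFieldDeRham"]
def Assembly : Prop :=
  ReciprocityModuloDeRham → LArithmeticity → AlgebraicTraceRigidity → _root_.Langlands

/-! D-0027 §2.1 — DECIDING THEOREM (planner-authored via `route open/edit --closes-file`; by operator:999:3686070 2026-08-31T08:08:13Z):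
its hypotheses are this route's items and its conclusion the sub-problem Statement (glue_lint), and it elaborates with this file. -/

/-- D-0027 §2.1 deciding theorem of route HeckeFieldDeRham — rev-3 REPAIR for the `∃ 𝓡 ↦ Nonempty ∧ ∀ 𝓡` re-type of
the summit (2026-08-16; `route.stale-verdict`: L346 `And.intro Rec` datum-vs-`Nonempty`, L348 `⟨…⟩` on the `∀ hcpt` binder):
the three load-bearing items prove, EXACTLY as at rev 2 (text verbatim, now the proof of `hEx`), the `∃`-form `Langlands_∃` —
`ReciprocityModuloDeRham` supplies ONE pinned datum `Rec` per field with (A′) ∧ (B), `LArithmeticity` the finite Hecke field,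
`AlgebraicTraceRigidity` the de Rham upgrade.  The re-typed summit `∀ F, Nonempty (ReciprocityData F) ∧ ∀ R′, …` then follows by
TRANSPORT of (A) ∧ (B) from `Rec` to an arbitrary pinned datum `R′` along the rigidity Rʷ on local components of L-algebraic
cuspidal `π` — the SHARED support item `RecRigidity` (stmt-Langlands-23603 verbatim; wanted by RootDecomp1 · RetentionCarving ·
PurityCarving · IwahoriBlockSplit · SphericalRigiditySplit · LiftDescend · BaseFieldAscent): `Corresponds R ι π ρ` reads the datum only
through `rec_n` of the local components of `π` (the `p`-adic Hodge datum is pinned), so (A), its uniqueness clause (transported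
backwards) and (B) pass from `Rec` to `R′` — the argument of the landed
`Theorems.ReciprocityRigidity.globalLanglands_transport_of_isLAlgebraic`, INLINED so that the route file imports nothing new
(necessity of Rʷ for the re-typed summit: `Theorems.ReciprocityRigidity.Tightness`).  `OrdinaryArtinWeightRigidity`,
`TangentRigidity` and the bookkeeping `Assembly` are not hypotheses. -/
@[closes "route-Langlands-HeckeFieldDeRham"] theorem closes (hR : ReciprocityModuloDeRham) (hL : LArithmeticity) (hT : AlgebraicTraceRigidity)
    (hRig : RecRigidity) : _root_.Langlands := by
  -- (1) the `∃`-form, proof VERBATIM from rev 2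
  have hEx : ∀ (F : Type) [Field F] [NumberField F], ∃ Rec : Summit.Langlands.ReciprocityData F, ∀ n : ℕ, 0 < n →
      ∀ hcpt : Literature.NumberTheory.Automorphic.isCompact_glFiniteIntegralLevel n F,
        Summit.Langlands.GlobalLanglandsCorrespondenceGLn n F Rec hcpt := by
    intro F _ _
    obtain ⟨Rec, hRec⟩ := hR F
    refine ⟨Rec, fun n hn hcpt => ?_⟩
    obtain ⟨hA, hB⟩ := hRec n hn hcpt
    refine ⟨?_, hB⟩
    intro π hπ ℓ _ ι
    obtain ⟨ρ, hirr, hsat, hlgc, hlgcℓ, huniq⟩ := hA π hπ ℓ ι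
    obtain ⟨E, hEfin, hE⟩ := hL n F hcpt π hπ ℓ ι
    have hunr : ∀ᶠ v : IsDedekindDomain.HeightOneSpectrum (NumberField.RingOfIntegers F) in Filter.cofinite,
        ρ.IsUnramifiedAt v :=
      hsat.mono fun v ⟨_, _, hρ, _⟩ => hρ
    have hrat : ∀ᶠ v : IsDedekindDomain.HeightOneSpectrum (NumberField.RingOfIntegers F) in Filter.cofinite,
        ∃ P : Polynomial (PadicAlgCl ℓ), (∀ i : ℕ, P.coeff i ∈ E) ∧ ρ.HasFrobCharpolyAt v P := by
      filter_upwards [hsat, hE] with v ⟨α, hα, _, hchar⟩ hEv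
      exact ⟨_, hEv α hα, hchar⟩
    have hdR := hT F n ℓ ρ hirr hunr ⟨E, hEfin, hrat⟩
    have hgeo : Summit.Langlands.IsGeometricFramed Rec ρ := ⟨hunr, fun v hv => hdR v hv⟩
    refine ⟨ρ, hirr, hgeo, ⟨hsat, fun v => ?_⟩, huniq⟩
    by_cases hv : ((ℓ : ℕ) : NumberField.RingOfIntegers F) ∈ v.asIdeal
    · exact hlgcℓ v hv (hdR v hv)
    · exact hlgc v hv
  -- (2) transport from `Rec` to every pinned datum `R'` along Rʷ (= `RecRigidity`)
  intro F _ _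
  obtain ⟨Rec, hRec⟩ := hEx F
  refine ⟨⟨Rec⟩, fun R' n hn hcpt => ?_⟩
  obtain ⟨hA, hB⟩ := hRec n hn hcpt
  -- `Corresponds` is transported along two data that agree on the local components of `π`
  have hct : ∀ (R₁ R₂ : Summit.Langlands.ReciprocityData F) {ℓ : ℕ} [Fact ℓ.Prime] (ι : PadicAlgCl ℓ ≃+* ℂ)
      (π : Literature.NumberTheory.Automorphic.CuspidalAutomorphicRepData n F hcpt)
      (ρ : Literature.NumberTheory.GaloisRepresentations.FramedGaloisRep F (PadicAlgCl ℓ) n),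
      (∀ (v : IsDedekindDomain.HeightOneSpectrum (NumberField.RingOfIntegers F))
          (πv : Literature.NumberTheory.Automorphic.SmoothIrrep
            (Matrix.GeneralLinearGroup (Fin n) (v.adicCompletion F))),
          π.1.HasLocalComponentAt v πv.ρ →
            (R₁.llc v).recGL n (Literature.NumberTheory.Automorphic.IrrClass.mk πv) =
              (R₂.llc v).recGL n (Literature.NumberTheory.Automorphic.IrrClass.mk πv)) →
        Summit.Langlands.Corresponds R₁ ι π.1 ρ → Summit.Langlands.Corresponds R₂ ι π.1 ρ := by
    intro R₁ R₂ ℓ _ ι π ρ h hc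
    refine ⟨hc.1, fun v => ?_⟩
    obtain ⟨πv, r, rℂ, hπv, hlad, hpst, htr, hcls⟩ := hc.2 v
    refine ⟨πv, r, rℂ, hπv, hlad, hpst, htr, ?_⟩
    rw [← h v πv hπv]
    exact hcls
  -- Rʷ specialised to `Rec`, `R'` on L-algebraic cuspidal `π` of `GL_n(𝔸_F)`
  have hrig : ∀ π : Literature.NumberTheory.Automorphic.CuspidalAutomorphicRepData n F hcpt,
      π.1.IsLAlgebraic →
        ∀ (v : IsDedekindDomain.HeightOneSpectrum (NumberField.RingOfIntegers F))
          (πv : Literature.NumberTheory.Automorphic.SmoothIrrep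
            (Matrix.GeneralLinearGroup (Fin n) (v.adicCompletion F))),
          π.1.HasLocalComponentAt v πv.ρ →
            (Rec.llc v).recGL n (Literature.NumberTheory.Automorphic.IrrClass.mk πv) =
              (R'.llc v).recGL n (Literature.NumberTheory.Automorphic.IrrClass.mk πv) :=
    fun π hπ v πv h => hRig F Rec R' n hcpt hn π hπ v πv h
  refine ⟨fun π hLalg ℓ _ ι => ?_, fun ℓ _ ι ρ hirr hgeo => ?_⟩
  · -- (A) for `R'`, uniqueness transported backwards
    obtain ⟨ρ, hirr, hgeo, hcorr, huniq⟩ := hA π hLalg ℓ ι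
    exact ⟨ρ, hirr, hgeo, hct Rec R' ι π ρ (hrig π hLalg) hcorr,
      fun ρ' hcorr' => huniq ρ' (hct R' Rec ι π ρ'
        (fun v πv hπv => (hrig π hLalg v πv hπv).symm) hcorr')⟩
  · -- (B) for `R'`
    obtain ⟨π, hLalg, hcorr⟩ := hB ℓ ι ρ hirr hgeo
    exact ⟨π, hLalg, hct Rec R' ι π ρ (hrig π hLalg) hcorr⟩

end Summit.Langlands.Langlands.Theses.HeckeFieldDeRham
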